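import Literature.MathematicalPhysics.QuantumFieldTheory.Balaban1983to89.B8Prop6Reg335ZdAllTorus
import Literature.MathematicalPhysics.QuantumFieldTheory.Balaban1983to89.B8Ineq159FlatCubeMemberTransplantL3

/-!
# `Balaban1983to89.B8Prop6PrintedZdCubPGammaL3` — [Balaban1985RegularSpaces] PROPOSITION 6 (p. 99), (1.135)–(1.138), FOR EVERY ODD `L ≥ 3`: the `L ≥ 3` TWINS of
# the γ-crown `B8Prop6CubeMemberScalarGammaHolds.gaugedBoundB8_cubeMember_scalar_γ_holds` (every print-faithful cube), of the family sentence
# `B8Prop6PrintedZdCubPGamma.prop6Printed_zdCubP_γ_holds` (print's p. 98 cube class `zdCubP`) and of the all-torus (3.35) supplier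
# `B8Prop6Reg335ZdAllTorus.prop6At_bgZd_allTorus_holds` ([4] (3.35) on the p. 396 class cubes at `Ω ≡ ℤᵈ`) — `hL5 : 5 ≤ L` replaced by `hL3 : 3 ≤ L`

statement-level skeleton of published theorems with citation tags; proofs where landed; nothing here is a claim about the
Yang–Mills mass gap

WHY THIS FILE.  In the whole N05 γ-chain the floor `5 ≤ L` is read by ONE binder: the named flat fact `B8Ineq159FlatCubeMemberPrinted.Ineq159FlatCubeMemberPrinted d L`
([B8] (1.59) at `U₀ = 1` on the cube member = [4] Thm 3.3 ∕ [B6] Prop. 2.6 at `U = 1`) was proved by dag-n05-c's transplant for odd `L ≥ 5` only, because the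
lit-balaban torus reading it transplants to was the L0 one.  `B8Ineq159FlatCubeMemberTransplantL3.ineq159FlatCubeMemberPrinted_holds_L3` proves the SAME named fact
for every odd `L ≥ 3` (V1L3 lineage underneath).  Every downstream theorem already weakened the floor at once — the γ-crown
`B8Prop6CubeMemberScalarGammaOfIneq159Printed.gaugedBoundB8_cubeMember_scalar_γ_of_ineq159Printed` asks `2 ≤ L ∧ 5 ≤ d·L` (true for `d ≥ 2`, `L ≥ 3`), the
`zdCubP` junction `prop6Printed_zdCubP_of_perCubeLetterPow` asks `2 ≤ L`, the all-torus frame `exists_prop6At_bgZd_allTorus_of_prop6Printed` asks `2 ≤ L` — so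
the three proofs below are those of the L5 theorems LETTER FOR LETTER with the new named-fact supplier:
* §1 ★★ `gaugedBoundB8_cubeMember_scalar_γ_holds_L3` — Prop. 6 `GaugedBoundB8 L η U₀ c (7dL²·5dLB₀·Mα₀)` at every cube of print's big-block sub-lattice above
  threshold, `d ≥ 2`, odd `L ≥ 3`;
* §2 ★★ `prop6Printed_zdCubP_γ_holds_L3` (+ `_pos_L3`, `_dvd_L3`) — the family sentence `B8.Prop6Printed d L (5dLB₀) c₁ (zdCubP 𝔸 L ρ₀ ∘ f)`, odd `L ≥ 3`;
* §3 ★★ `prop6At_bgZd_allTorus_holds_L3` (+ `prop6At_binder_allTorusPinned_holds_L3`) — dag-n06-b's junction binder `Prop6At (bgZd 𝔸 L) …` at every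
  all-torus member, odd `L ≥ 3` ((3.35) on [4]'s p. 396 class cubes, «O(1)Mα₀ = c35·M·K₆α₀»).
Consumer (rung R3, `Summits/`): the (3.35) ∧ (3.36) class-cube supplier `Prop7SectET3ClassTransferZdL3.reg336Cube_zd_of_inAk_L3` of the T³ class-transfer row.

HONEST SCOPE ∕ A6.  By-name re-pointing of LANDED theorems (standard axioms); no module of the γ ∕ n05-c ∕ n05-e ∕ k0-s2 ∕ lit-balaban lineages is touched; no
fact minted; the record-facing `θ : Stage3Params` forms (§4 of `B8Prop6PrintedZdCubPGamma`) are NOT twinned here (their consumers carry `θ.L ≥ 8` anyway).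
WHAT IS PROVED is the tree's sentences at `3 ≤ L` in place of `5 ≤ L`; whether NODE 00's letters carry the full content of print's (1.135)–(1.138) ∕ p. 98 is the
carriers' LOCATED question of record, unchanged.  NOT PROVED ∕ NOT CLAIMED: anything for even `L`; N05 not discharged by this file; count-neutral; one finite
lattice programme at fixed spacing, Bałaban as printed; nothing continuum ∕ ℝ⁴ ∕ OS ∕ mass-gap ∕ Clay.  No `sorry`, no `def`, no `instance`, no `notation`.
Cell `pub∕ym-inputs` seat `ym-inputs-p06` g2 (ym3-torus L-FLOOR LEDGER, Prop-6 component), 2026-08-28.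

PDF held: `paper:balaban1985-cmp99-regular-spaces-gauge-fixing`; Prop. 6 p. 99, p. 98, Thm 4 p. 88, Prop. 3 p. 87, (1.59) p. 86, (1.33) p. 82.
[4] = [Balaban1985BackgroundPropagators] Thm 3.3 p. 399, (3.35) p. 396; [B6] = [Balaban1984PropagatorsII] Prop. 2.6 (2.136) p. 247.
-/

noncomputable section

open NormedSpace

namespace Literature.MathematicalPhysics.QuantumFieldTheory.Balaban1983to89.B8Prop6PrintedZdCubPGammaL3

open B7Prop1Explicit B7Prop2Explicit B7Prop1Local
open B8Ineq132 (InAk)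
open B8LeafModelZd (ZdIdx)
open B8Ineq159FlatCubeMemberTransplantL3 (ineq159FlatCubeMemberPrinted_holds_L3)
open B8Prop6CubeMemberScalarGammaOfIneq159Printed (gaugedBoundB8_cubeMember_scalar_γ_of_ineq159Printed)
open B8Prop6PrintedZdCubPGamma (prop6Printed_zdCubP_of_perCubeLetterPow)
open B8Prop6Reg335ZdAllTorus (exists_prop6At_bgZd_allTorus_of_prop6Printed)
open B9SupplySockB9P3ZdAt (Prop6At)
open B9SupplySockB9P3ZdFrame (memZd bgZd ιCfgZd)
open Node00 (CubeB8 GaugedBoundB8 zdCubP prop6Printed_zdCubP_anti)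

export B7Prop1Explicit (Site)

variable {d : ℕ}

variable {𝔸 : Type} [CStarAlgebra 𝔸] [Nontrivial 𝔸]

/-! ## §1  ★★ Proposition 6 at every cube of print's big-block sub-lattice — `d ≥ 2`, odd `L ≥ 3` -/

open Classical in
/-- ★★ **PROPOSITION 6 (p. 99), (1.135)–(1.138), AT EVERY CUBE OF PRINT'S BIG-BLOCK SUB-LATTICE — `d ≥ 2`, ODD `L ≥ 3`**: the `L ≥ 3` twin of
`B8Prop6CubeMemberScalarGammaHolds.gaugedBoundB8_cubeMember_scalar_γ_holds` (statement VERBATIM with `hL5 : 5 ≤ L` replaced by `hL3 : 3 ≤ L`).  There are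
`B₀ ≥ 1`, `c₁ > 0` and thresholds `ρ₀, M₀, N₀, R₀` (functions of `d, L`) such that for every `η > 0`, every cube `c : CubeB8 d L K Ω` whose datum lies on
print's p. 98 sub-lattice above threshold and every unitary `U₀ ∈ 𝔄_K({Ω_j}, α₀)` with `7dL²Mα₀ ≤ c₁`: `GaugedBoundB8 L η U₀ c (7dL²·5dLB₀·Mα₀)` — «there
exists a gauge transformation u defined on □̃ such that U₀^{u⁻¹} = U₁ = e^{iηA} on □̃ (1.135), Lʲη|A|, (Lʲη)²|∇^η A|, (Lʲη)³|∂^{η*}∂^η A|, (Lʲη)³|Δ^η A| ≤ 7dL²B₁Mα₀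
on □_j (1.136), Q_k(ηA) = (1∕i) log Ū₀′ᵏ on □^{(k)} (1.137)», Landau gauge (1.138) at background `1`.  PROOF: the γ-crown
`gaugedBoundB8_cubeMember_scalar_γ_of_ineq159Printed` (needs `2 ≤ L`, `5 ≤ d·L` — here `d·L ≥ 6`) at the `L ≥ 3` named fact `ineq159FlatCubeMemberPrinted_holds_L3 (d − 1) (L − 1)`.
[cite: Balaban1985RegularSpaces, Prop. 6 (1.135)–(1.138) p.99, p.98, Thm 4 p.88, Prop. 3 p.87, (1.59) p.86, (1.62) p.87, (1.31) p.82; Balaban1985BackgroundPropagators, Thm 3.3 p.399, Thm 3.2 (3.48) p.398, Thm 3.1 (3.47) p.398; Balaban1984PropagatorsII, Prop. 2.6 (2.136) p.247, (2.3) p.224] -/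
theorem gaugedBoundB8_cubeMember_scalar_γ_holds_L3 (hd2 : 2 ≤ d) {L : ℕ} (hL3 : 3 ≤ L) (hodd : Odd L) :
    ∃ B₀ c₁ ρ₀ M₀ : ℝ, ∃ N₀ R₀ : ℕ, 1 ≤ B₀ ∧ 0 < c₁ ∧ ∀ (η : ℝ), 0 < η → ∀ {K : ℕ} {Ω : ℕ → Set (Site d)} (c : CubeB8 d L K Ω),
      ∀ (s R : ℕ), 3 ≤ L ^ s → M₀ ≤ (L : ℝ) ^ (s + 1) → L ^ (s + 1) ∣ c.ρ → L ^ (s + 1) ∣ c.M → R * L ^ (s + 1) ≤ c.ρ → 2 * L ≤ R →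
        R₀ ≤ R → N₀ + 1 ≤ R * L ^ (s + 1) → ρ₀ ≤ (c.ρ : ℝ) →
      ∀ (U₀ : Site d → Fin d → 𝔸ˣ), (∀ x κ, U₀ x κ ∈ unitaryUnits 𝔸) → ∀ (α₀ : ℝ), 0 < α₀ → InAk L K η α₀ Ω U₀ →
      7 * d * (L : ℝ) ^ 2 * c.M * α₀ ≤ c₁ →
      GaugedBoundB8 L η U₀ c (7 * d * (L : ℝ) ^ 2 * (5 * (d : ℝ) * L * B₀) * c.M * α₀) := by
  obtain ⟨d', rfl⟩ : ∃ d', d = d' + 1 := ⟨d - 1, by omega⟩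
  obtain ⟨ℓ, rfl⟩ : ∃ ℓ, L = ℓ + 1 := ⟨L - 1, by omega⟩
  have hL : 2 ≤ ℓ + 1 := by omega
  have hdL : 5 ≤ (d' + 1) * (ℓ + 1) := le_trans (by norm_num) (Nat.mul_le_mul hd2 hL3)
  exact gaugedBoundB8_cubeMember_scalar_γ_of_ineq159Printed (𝔸 := 𝔸) hd2 hL hdL (ineq159FlatCubeMemberPrinted_holds_L3 d' ℓ (by omega) hodd)

/-! ## §2  ★★ Proposition 6 as printed on print's p. 98 cube class, family level — `d ≥ 2`, odd `L ≥ 3` -/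

/-- ★★ **[B8] PROPOSITION 6 AS PRINTED, ON PRINT'S p. 98 CUBE CLASS, AT THE FAMILY LEVEL — `d ≥ 2`, ODD `L ≥ 3`** (every coefficient C⋆-algebra `𝔸`, every
index map `f`): the `L ≥ 3` twin of `B8Prop6PrintedZdCubPGamma.prop6Printed_zdCubP_γ_holds` (statement VERBATIM, `hL5` ↦ `hL3`).  There are a big-block size
`ρ₀ ≥ 1` (print's `R₁M₁`), `B₀ ≥ 1` and `c₁ > 0` such that `B8.Prop6Printed d L (5dLB₀) c₁ (zdCubP 𝔸 L ρ₀ ∘ f)`: at every PRINT cube `c` at `ρ₀` with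
«7dL²Mα₀ ≤ c₁» and every unitary `U₀ ∈ 𝔄_k({Ω_j}, α₀)`, `GaugedBoundB8` ((1.135)–(1.138), `B₁ = 5dLB₀`).  PROOF: §1 ∘ the junction
`B8Prop6PrintedZdCubPGamma.prop6Printed_zdCubP_of_perCubeLetterPow` (`2 ≤ L`).
[cite: Balaban1985RegularSpaces, Prop. 6 (1.135)–(1.138) p.99, p.98 («R₁, M₁ are smallest integers for which all the theorems of the papers [2, 4] are valid … M is a multiple of R₁M₁»), Thm 4 (1.68) p.88 («B₁ = 5dLB₀»)] -/
theorem prop6Printed_zdCubP_γ_holds_L3 (hd2 : 2 ≤ d) {L : ℕ} (hL3 : 3 ≤ L) (hodd : Odd L) :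
    ∃ ρ₀ : ℕ, ∃ B₀ c₁ : ℝ, 1 ≤ ρ₀ ∧ 1 ≤ B₀ ∧ 0 < c₁ ∧
      ∀ {ι : Type} (f : ι → ZdIdx d L), B8.Prop6Printed d (L : ℝ) (5 * (d : ℝ) * L * B₀) c₁ (fun j => zdCubP 𝔸 L ρ₀ (f j)) := by
  have hL2 : 2 ≤ L := le_trans (by norm_num) hL3
  obtain ⟨B₀, c₁, ρ₀', M₀, N₀, R₀, hB₀, hc₁, G⟩ := gaugedBoundB8_cubeMember_scalar_γ_holds_L3 (𝔸 := 𝔸) hd2 hL3 hodd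
  obtain ⟨ρ₀, hρ₀, H⟩ := prop6Printed_zdCubP_of_perCubeLetterPow (𝔸 := 𝔸) (B₁ := 5 * (d : ℝ) * L * B₀) (c₁ := c₁) hL2
    (fun η hη K Ω c s R h3 hM₀ h1 h2 h3' h2L hR₀ hN₀ h4 U₀ hU α₀ hα hInA hs => by
      have := G η hη c s R h3 hM₀ h1 h2 h3' h2L hR₀ hN₀ h4 U₀ hU α₀ hα hInA hs
      simpa only [mul_assoc] using this)
  exact ⟨ρ₀, B₀, c₁, hρ₀, hB₀, hc₁, fun f => H f⟩

/-- ★ **[B8] PROPOSITION 6 AS PRINTED ON PRINT'S CLASS, FAMILY LEVEL, WITH A POSITIVE CONSTANT `B₁ > 0`** (`d ≥ 2`, odd `L ≥ 3`): the `L ≥ 3` twin of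
`B8Prop6PrintedZdCubPGamma.prop6Printed_zdCubP_γ_holds_pos` (`B₁ := 5dLB₀ > 0`). [cite: Balaban1985RegularSpaces, Prop. 6 (1.135)–(1.138) p.99, p.98] -/
theorem prop6Printed_zdCubP_γ_holds_pos_L3 (hd2 : 2 ≤ d) {L : ℕ} (hL3 : 3 ≤ L) (hodd : Odd L) :
    ∃ ρ₀ : ℕ, ∃ B₁ c₁ : ℝ, 1 ≤ ρ₀ ∧ 0 < B₁ ∧ 0 < c₁ ∧
      ∀ {ι : Type} (f : ι → ZdIdx d L), B8.Prop6Printed d (L : ℝ) B₁ c₁ (fun j => zdCubP 𝔸 L ρ₀ (f j)) := by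
  obtain ⟨ρ₀, B₀, c₁, hρ₀, hB₀, hc₁, H⟩ := prop6Printed_zdCubP_γ_holds_L3 (𝔸 := 𝔸) hd2 hL3 hodd
  refine ⟨ρ₀, 5 * (d : ℝ) * L * B₀, c₁, hρ₀, ?_, hc₁, fun f => H f⟩
  have hd : (0 : ℝ) < d := by exact_mod_cast (lt_of_lt_of_le (by norm_num) hd2)
  have hL : (0 : ℝ) < L := by exact_mod_cast (lt_of_lt_of_le (by norm_num) hL3)
  have hB : (0 : ℝ) < B₀ := lt_of_lt_of_le one_pos hB₀
  positivity

/-- ★ **WLOG THE BIG BLOCK IS A MULTIPLE OF ANY GIVEN `t ≥ 1`** (`d ≥ 2`, odd `L ≥ 3`): the `L ≥ 3` twin of `B8Prop6PrintedZdCubPGamma.prop6Printed_zdCubP_γ_holds_dvd`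
(`Node00.prop6Printed_zdCubP_anti`: every `ρ₀t`-cube is a `ρ₀`-cube). [cite: Balaban1985RegularSpaces, Prop. 6 p.99, p.98 («M is a multiple of R₁M₁»)] -/
theorem prop6Printed_zdCubP_γ_holds_dvd_L3 (hd2 : 2 ≤ d) {L : ℕ} (hL3 : 3 ≤ L) (hodd : Odd L) {t : ℕ} (ht : 1 ≤ t) :
    ∃ ρ₀ : ℕ, ∃ B₁ c₁ : ℝ, 1 ≤ ρ₀ ∧ t ∣ ρ₀ ∧ 0 < B₁ ∧ 0 < c₁ ∧
      ∀ {ι : Type} (f : ι → ZdIdx d L), B8.Prop6Printed d (L : ℝ) B₁ c₁ (fun j => zdCubP 𝔸 L ρ₀ (f j)) := by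
  obtain ⟨ρ₀, B₁, c₁, hρ₀, hB₁, hc₁, H⟩ := prop6Printed_zdCubP_γ_holds_pos_L3 (𝔸 := 𝔸) hd2 hL3 hodd
  refine ⟨ρ₀ * t, B₁, c₁, ?_, Dvd.intro_left _ rfl, hB₁, hc₁, fun f => prop6Printed_zdCubP_anti f (Dvd.intro _ rfl) (H f)⟩
  exact Nat.one_le_iff_ne_zero.2 (Nat.mul_ne_zero (by omega) (by omega))

/-! ## §3  ★★ (3.35) on [4]'s p. 396 class cubes at every all-torus member — `d ≥ 2`, odd `L ≥ 3` -/

/-- ★★ **[B8] PROPOSITION 6's PRINTED APPLICATION AT THE ALL-TORUS MEMBERS — `d ≥ 2`, ODD `L ≥ 3`** (any nontrivial C⋆-algebra `𝔸`): the `L ≥ 3` twin of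
`B8Prop6Reg335ZdAllTorus.prop6At_bgZd_allTorus_holds`.  There are `c35, c₆, K₆ > 0` such that for every block parameter `M ≥ 1`, every all-torus member
`i : ZdIdx d L` (`∀ j, i.Ω j = univ`) and every truncation `m`, dag-n06-b's junction binder `Prop6At (bgZd 𝔸 L) L memZd (ιCfgZd 𝔸 L) c35 c₆ K₆ M i m` — «U₀ ∈
𝔄_m({Ω_j}, α₀), Mα₀ ≤ c₆ ⇒ U₀ satisfies (3.35) of [4] on the p. 396 cube class with O(1)Mα₀ = c35·M·K₆α₀» — HOLDS.  PROOF: §2 ∘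
`B8Prop6Reg335ZdAllTorus.exists_prop6At_bgZd_allTorus_of_prop6Printed` (`2 ≤ L`).
[cite: Balaban1985RegularSpaces, Prop. 6 (1.135)–(1.138) p.99, (1.33) p.82, p.98; Balaban1985BackgroundPropagators, (3.35) p.396] -/
theorem prop6At_bgZd_allTorus_holds_L3 (hd2 : 2 ≤ d) {L : ℕ} (hL3 : 3 ≤ L) (hodd : Odd L) :
    ∃ c35 c₆ K₆ : ℝ, 0 < c35 ∧ 0 < c₆ ∧ 0 < K₆ ∧
      ∀ (M : ℝ) (i : ZdIdx d L) (m : ℕ), (∀ j, i.Ω j = Set.univ) → 1 ≤ M →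
        Prop6At (bgZd 𝔸 L) L memZd (ιCfgZd 𝔸 L) c35 c₆ K₆ M i m := by
  obtain ⟨ρ₀, B₀, c₁, hρ₀, hB₀, hc₁, H⟩ := prop6Printed_zdCubP_γ_holds_L3 (𝔸 := 𝔸) hd2 hL3 hodd
  have hB₁ : 0 ≤ 5 * (d : ℝ) * L * B₀ := by
    have : (0 : ℝ) ≤ B₀ := le_trans zero_le_one hB₀
    positivity
  exact exists_prop6At_bgZd_allTorus_of_prop6Printed hd2 (le_trans (by norm_num) hL3) hρ₀ hB₁ hc₁ (fun f => H f)

/-- ★ **THE CONSUMERS' BINDER SHAPE, `d ≥ 2`, ODD `L ≥ 3`**: the `L ≥ 3` twin of `B8Prop6Reg335ZdAllTorus.prop6At_binder_allTorusPinned_holds` — for any further pin `P`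
on the datum there are `c35 c₆ K₆ M₃ > 0` (`M₃ = 1`) with the `Prop6At (bgZd 𝔸 L) …` binder AS TYPED on `{i // (∀ j, i.Ω j = univ) ∧ P i}`.
[cite: Balaban1985RegularSpaces, Prop. 6 p.99, (1.33) p.82; Balaban1985BackgroundPropagators, (3.35) p.396, Thm 3.3 p.399] -/
theorem prop6At_binder_allTorusPinned_holds_L3 (hd2 : 2 ≤ d) {L : ℕ} (hL3 : 3 ≤ L) (hodd : Odd L) (P : ZdIdx d L → Prop) :
    ∃ c35 c₆ K₆ M₃ : ℝ, 0 < c35 ∧ 0 < c₆ ∧ 0 < K₆ ∧ 0 < M₃ ∧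
      ∀ (M : ℝ) (i : {i : ZdIdx d L // (∀ j, i.Ω j = Set.univ) ∧ P i}) (m : ℕ), M₃ ≤ M →
        Prop6At (bgZd 𝔸 L) L memZd (ιCfgZd 𝔸 L) c35 c₆ K₆ M i.1 m := by
  obtain ⟨c35, c₆, K₆, h35, h₆, hK, H⟩ := prop6At_bgZd_allTorus_holds_L3 (𝔸 := 𝔸) hd2 hL3 hodd
  exact ⟨c35, c₆, K₆, 1, h35, h₆, hK, one_pos, fun M i m hM => H M i.1 m i.2.1 hM⟩

end Literature.MathematicalPhysics.QuantumFieldTheory.Balaban1983to89.B8Prop6PrintedZdCubPGammaL3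

end
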